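import Summits.ResolutionOfSingularities.ResolutionOfSingularities.Theorems.PurelyInseparableDim4PureLeafFpGlobalWin
import Summits.ResolutionOfSingularities.ResolutionOfSingularities.Theorems.PurelyInseparableDim4InScopeWinCert
import HarnessLib
import HarnessLib.Audit.Tags

/-!
# Purely inseparable fourfolds — COROLLARIES of D3c: in-scope form, `Fin 4 →₀ ℕ` forms, and the degenerate `p`-th-power leaf
# (cell res-dim4-pi; companions of `…PureLeafFpGlobalWin`)
# [OURS · counted 0 · statements about OUR coordinate-centre frame v4, not about resolution]

Width seat `res-dim4-p-10` (g3).  Small consequences of `PureLeafNF.stateWins_monomial_zmod` /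
`PureLeafNF.no_step1h_chain_monomial_zmod` (every prime `p`, pure leaves `x^a` with some `p ∤ aᵢ`, over `𝔽_p`):

* `inScopeStateWins_monomial_zmod` — in-scope escapable (F4-C attractor) for every booking;
* `no_step1h_chain_monomial_zmod'` — the `Fin 4 →₀ ℕ` form of MODE-1h termination;
* the DEGENERATE leaf `x^{a}` with EVERY `aᵢ` divisible by `p` (a `p`-th power, not a clean state): every reply cleans to `0`, so
  it is an A-win with no real play and no MODE-1h step leaves it (`step_F_eq_zero_of_forall_dvd`, `stateWins_monomial_zmod_of_forall_dvd`,
  `no_step1h_chain_monomial_zmod_of_forall_dvd`) — hence **`stateWins_monomial_zmod_all`** / **`no_step1h_chain_monomial_zmod_all`**: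
  the two headlines for EVERY exponent vector, no hypothesis.

Nothing here proves resolution of singularities in dimension ≥ 4 / characteristic `p`; counted 0; AI work, weaker than expert
review. bears_on: LADDER-RESOLUTION:D157-DOOR2 (res-dim4-pi · D3c corollaries). Supports stmt-ResolutionOfSingularities-16155 (helper).
-/

set_option linter.dupNamespace false

open MvPolynomial Finset

open scoped BigOperators

noncomputable section

namespace Summit.ResolutionOfSingularities.ResolutionOfSingularities.Theorems.PIDim4

namespace PureLeafNF

open Literature.AlgebraicGeometry.Resolution
open Literature.AlgebraicGeometry.Resolution.Hauser2010
open CentreBlowup PthPowerFactor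

variable (p : ℕ) [Fact p.Prime]

/-! ## 1. In-scope and finitely-supported forms -/

/-- Every pure leaf with some `p ∤ aᵢ` is in-scope escapable over `𝔽_p`, every booking. [OURS · counted 0] [folklore] -/
theorem inScopeStateWins_monomial_zmod (a : Fin 4 → ℕ) (ha : ∃ i, ¬ p ∣ a i) (r : Fin 4 →₀ ℕ) (exc : Finset (Fin 4)) :
    InScopeWinCert.InScopeStateWins p (⟨monomial (Finsupp.equivFunOnFinite.symm a) 1, r, exc⟩ : State (ZMod p)) :=
  InScopeWinCert.inScopeStateWins_of_stateWins (stateWins_monomial_zmod p a ha r exc)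

/-- MODE-1h termination from pure leaves, `Fin 4 →₀ ℕ` form. [OURS · counted 0] [folklore] -/
theorem no_step1h_chain_monomial_zmod' (a : Fin 4 →₀ ℕ) (ha : ∃ i, ¬ p ∣ a i) (r : Fin 4 →₀ ℕ)
    (exc : Finset (Fin 4)) :
    ¬ ∃ ch : ℕ → State (ZMod p), ch 0 = (⟨monomial a 1, r, exc⟩ : State (ZMod p)) ∧ ∀ k, Step1h p (ch k) (ch (k + 1)) := by
  have h := no_step1h_chain_monomial_zmod p (⇑a) ha r exc
  rwa [Finsupp.equivFunOnFinite_symm_coe] at h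

/-! ## 2. The degenerate `p`-th-power leaf -/

/-- A `p`-th-power leaf `x^{a}` (`p ∣ aᵢ` for all `i`) in the general form with `μ = 0` and constant `0`. [folklore] -/
theorem monomial_eq_generalForm_of_forall_dvd (a : Fin 4 → ℕ) (ha : ∀ i, p ∣ a i) :
    (monomial (Finsupp.equivFunOnFinite.symm a) (1 : ZMod p)) =
      expand p (∏ i : Fin 4, ∏ c : ZMod p, (X i + C c) ^ (if c = 0 then a i / p else 0) : MvPolynomial (Fin 4) (ZMod p)) *
        ((∏ i : Fin 4, ∏ c : ZMod p, (X i + C c : MvPolynomial (Fin 4) (ZMod p)) ^ (fun (_ : Fin 4) (_ : ZMod p) => 0) i c) -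
          C 0) := by
  rw [generalForm_C_zero, splitForm_eq_monomial_mul]
  have hunit : (∏ i : Fin 4, ∏ c ∈ Finset.univ.erase (0 : ZMod p),
      ((X i + C c : MvPolynomial (Fin 4) (ZMod p)) ^
        (p * (if c = 0 then a i / p else 0) + (fun (_ : Fin 4) (_ : ZMod p) => 0) i c))) = 1 :=
    Finset.prod_eq_one fun i _ => Finset.prod_eq_one fun c hc => by
      rw [if_neg (Finset.ne_of_mem_erase hc), mul_zero, zero_add, pow_zero]
  rw [hunit, mul_one]
  refine congrArg (fun d => monomial d (1 : ZMod p)) ?_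
  ext i
  show a i = p * (if (0 : ZMod p) = 0 then a i / p else 0) + 0
  rw [if_pos rfl, add_zero, Nat.mul_div_cancel' (ha i)]

/-- **Every reply to a `p`-th-power leaf cleans to `0`** (singleton centre `{x_j}` with `p ≤ a_j`). [folklore] -/
theorem step_F_eq_zero_of_forall_dvd (s : State (ZMod p)) (a : Fin 4 → ℕ) (ha : ∀ i, p ∣ a i)
    (hF : s.F = monomial (Finsupp.equivFunOnFinite.symm a) 1) {j : Fin 4} (hj : p ≤ a j) (b : Fin 4 → ZMod p) :
    (step p {j} j b s).F = 0 := by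
  rw [monomial_eq_generalForm_of_forall_dvd p a ha] at hF
  have hj' : 1 ≤ (fun (i : Fin 4) (c : ZMod p) => if c = 0 then a i / p else 0) j 0 := by
    show 1 ≤ (if (0 : ZMod p) = 0 then a j / p else 0)
    rw [if_pos rfl]
    exact (Nat.le_div_iff_mul_le (Fact.out : p.Prime).pos).mpr (by rw [one_mul]; exact hj)
  rw [step_singleton_generalForm p s _ _ 0 hF (fun _ _ => (Fact.out : p.Prime).pos) (fun _ _ h => absurd rfl h) hj' b]
  have h1 : (∏ i : Fin 4, ∏ c : ZMod p, (X i + C c : MvPolynomial (Fin 4) (ZMod p)) ^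
      (fun (_ : Fin 4) (_ : ZMod p) => (0 : ℕ)) i (c - b i)) = 1 :=
    Finset.prod_eq_one fun i _ => Finset.prod_eq_one fun c _ => pow_zero _
  have h2 : (∏ i : Fin 4, ∏ c : ZMod p, (c : ZMod p) ^ (fun (_ : Fin 4) (_ : ZMod p) => (0 : ℕ)) i (c - b i)) = 1 :=
    Finset.prod_eq_one fun i _ => Finset.prod_eq_one fun c _ => pow_zero _
  rw [h1, h2, C_1, sub_self, mul_zero]

/-- Orders of a monomial leaf along coordinate centres. [folklore] -/
theorem ordAlong_monomial_leaf (a : Fin 4 → ℕ) (S : Finset (Fin 4)) :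
    ordAlong S (monomial (Finsupp.equivFunOnFinite.symm a) (1 : ZMod p)) = ((∑ i ∈ S, a i : ℕ) : ℕ∞) := by
  rw [ordAlong_monomial S _ one_ne_zero]
  rfl

/-- **The degenerate leaf is an A-win** (no real play: if `a ≠ 0` the centre `{x_j}` with `a_j ≥ p` has no edge; `a = 0` has no centre).
[OURS · counted 0] [folklore] -/
theorem stateWins_monomial_zmod_of_forall_dvd (a : Fin 4 → ℕ) (ha : ∀ i, p ∣ a i) (r : Fin 4 →₀ ℕ) (exc : Finset (Fin 4)) :
    StateWins p (⟨monomial (Finsupp.equivFunOnFinite.symm a) 1, r, exc⟩ : State (ZMod p)) := by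
  unfold StateWins
  by_cases h0 : ∃ j, a j ≠ 0
  · obtain ⟨j, hj⟩ := h0
    have hpj : p ≤ a j := Nat.le_of_dvd (Nat.pos_of_ne_zero hj) (ha j)
    refine Game.Wins.move (m := ({j} : Finset (Fin 4))) ⟨Finset.singleton_nonempty j, ?_⟩ ?_
    · show (p : ℕ∞) ≤ ordAlong {j} (monomial (Finsupp.equivFunOnFinite.symm a) (1 : ZMod p))
      rw [ordAlong_monomial_leaf, Finset.sum_singleton]
      exact_mod_cast hpj
    · rintro s' ⟨j', b, hj', -, -, hne, -⟩
      rw [Finset.mem_singleton] at hj'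
      subst hj'
      exact absurd (step_F_eq_zero_of_forall_dvd p _ a ha rfl hpj b) hne
  · push Not at h0
    refine Game.Wins.terminal fun S hS => ?_
    have h2 := hS.2
    change (p : ℕ∞) ≤ ordAlong S (monomial (Finsupp.equivFunOnFinite.symm a) (1 : ZMod p)) at h2
    rw [ordAlong_monomial_leaf, Finset.sum_eq_zero (fun i _ => h0 i)] at h2
    have : p ≤ 0 := by exact_mod_cast h2
    exact absurd (Fact.out : p.Prime).pos (not_lt.mpr this)

/-- **No MODE-1h step leaves the degenerate leaf.** [OURS · counted 0] [folklore] -/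
theorem no_step1h_chain_monomial_zmod_of_forall_dvd (a : Fin 4 → ℕ) (ha : ∀ i, p ∣ a i) (r : Fin 4 →₀ ℕ)
    (exc : Finset (Fin 4)) :
    ¬ ∃ ch : ℕ → State (ZMod p),
      ch 0 = (⟨monomial (Finsupp.equivFunOnFinite.symm a) 1, r, exc⟩ : State (ZMod p)) ∧
        ∀ k, Step1h p (ch k) (ch (k + 1)) := by
  rintro ⟨ch, hch0, hch⟩
  obtain ⟨S, ⟨hperm, hmin⟩, j, b, hjS, -, -, hne, -⟩ := hch 0
  rw [hch0] at hperm hmin hne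
  -- the permissible `S` contains some `j₀` with `a_{j₀} ≥ 1`, hence `≥ p`; the singleton `{j₀}` is permissible, so `S` is a singleton
  have hsum : p ≤ ∑ i ∈ S, a i := by
    have h2 := hperm.2
    change (p : ℕ∞) ≤ ordAlong S (monomial (Finsupp.equivFunOnFinite.symm a) (1 : ZMod p)) at h2
    rw [ordAlong_monomial_leaf] at h2
    exact_mod_cast h2
  obtain ⟨j₀, hj₀S, hj₀⟩ : ∃ j₀ ∈ S, a j₀ ≠ 0 := by
    by_contra hno
    push Not at hno
    rw [Finset.sum_eq_zero hno] at hsum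
    exact absurd (Fact.out : p.Prime).pos (not_lt.mpr hsum)
  have hpj₀ : p ≤ a j₀ := Nat.le_of_dvd (Nat.pos_of_ne_zero hj₀) (ha j₀)
  have hperm₀ : IsPermissibleCentre p {j₀} (monomial (Finsupp.equivFunOnFinite.symm a) (1 : ZMod p)) := by
    refine ⟨Finset.singleton_nonempty j₀, ?_⟩
    rw [ordAlong_monomial_leaf, Finset.sum_singleton]
    exact_mod_cast hpj₀
  have hcard := hmin {j₀} hperm₀
  rw [Finset.card_singleton] at hcard
  obtain ⟨j', hj'⟩ := Finset.card_eq_one.mp (le_antisymm hcard (Finset.card_pos.mpr hperm.1))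
  rw [hj', Finset.mem_singleton] at hjS
  subst hjS
  rw [hj'] at hsum hne
  rw [Finset.sum_singleton] at hsum
  exact hne (step_F_eq_zero_of_forall_dvd p _ a ha rfl hsum b)

/-! ## 3. The headlines for EVERY exponent vector -/

/-- **EVERY PURE MONOMIAL `x^a`, EVERY BOOKING, EVERY PRIME `p`: an A-win of the plain global game over `𝔽_p`.**
[OURS · counted 0] [folklore] -/
theorem stateWins_monomial_zmod_all (a : Fin 4 → ℕ) (r : Fin 4 →₀ ℕ) (exc : Finset (Fin 4)) :
    StateWins p (⟨monomial (Finsupp.equivFunOnFinite.symm a) 1, r, exc⟩ : State (ZMod p)) := by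
  by_cases ha : ∃ i, ¬ p ∣ a i
  · exact stateWins_monomial_zmod p a ha r exc
  · push Not at ha
    exact stateWins_monomial_zmod_of_forall_dvd p a ha r exc

/-- **… and MODE 1h terminates from it.** [OURS · counted 0] [folklore] -/
theorem no_step1h_chain_monomial_zmod_all (a : Fin 4 → ℕ) (r : Fin 4 →₀ ℕ) (exc : Finset (Fin 4)) :
    ¬ ∃ ch : ℕ → State (ZMod p),
      ch 0 = (⟨monomial (Finsupp.equivFunOnFinite.symm a) 1, r, exc⟩ : State (ZMod p)) ∧
        ∀ k, Step1h p (ch k) (ch (k + 1)) := by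
  by_cases ha : ∃ i, ¬ p ∣ a i
  · exact no_step1h_chain_monomial_zmod p a ha r exc
  · push Not at ha
    exact no_step1h_chain_monomial_zmod_of_forall_dvd p a ha r exc

end PureLeafNF

end Summit.ResolutionOfSingularities.ResolutionOfSingularities.Theorems.PIDim4

end
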